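import Summits.HubbardSuperconductivity.HubbardSuperconductivity.Theorems.AnisotropyChordTransferFibre3RowDRhoBound
import Summits.HubbardSuperconductivity.HubbardSuperconductivity.Theorems.AnisotropyChordTransferFibre3RowDTLoopMajE
import Summits.HubbardSuperconductivity.HubbardSuperconductivity.Theorems.AnisotropyChordTransferFibre3ManifoldA64

/-!
# Route `AnisotropyChord` / H0 rotor rung, row D (KT-2a) on the t-BLOCKS: block twin of `…AnisotropyChordTransferFibre3RowDRhoBound`

T-FORK (p2 g8; inventory memo HOME/hubbard-h0-rotor-p2/TBLOCK-INVENTORY-g8.md §3): the theorems of `…RowDRhoBound` that carry the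
hypothesis `128 ≤ L` (or the `L2.NamedCell` cell box) restated in the namespace `RowD.T` with the SAME names for the t-blocks of
the range `48 ≤ L < 128` (route-lead ruling R1): analytic layer with `64 ≤ L` (family A at `L ≥ 64`: `ManifoldA.nu_ceiling64`,
`manifold_band64`), cell layer on block cells `c : L2.TCell` (`cellBoxB (c.box a₁ a₂)`, `pmem_xTrueT`,
`RowC.finalVec_mem_of_cellFinalBoxT`).  Definitions that do not depend on the cell are NOT duplicated (they resolve to `RowD`);
proofs are verbatim.  Kept: monoLoop_le, loopTot_le, ntLoop_le, rhat_norm_le.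
Prover seat `hubbard-h0-rotor-p2` g8; helper for piece A = stmt-HubbardSuperconductivity-23918 of rung 19089 (`--supports`, helper
class).  Nothing here proves superconductivity in the Hubbard model; lemmas for ONE row of ONE conditional reduction on the t-blocks;
the rotor TARGET as originally worded stays FALSE (g15 verdict).  Tree imports only; no sorry.
-/

set_option linter.dupNamespace false
set_option autoImplicit false

open Literature.Analysis.ValidatedNumerics

namespace Summit.HubbardSuperconductivity.HubbardSuperconductivity.Theorems.AnisotropyChord.Transfer.Fibre3

namespace RowD

namespace T

open RowC L2.N1

variable (L : ℕ) [NeZero L]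

/-! ## The majorant `RExpr` -/

/-! ## The bound -/

section bound
variable (Δ lam2 : ℝ) (f : Tor L → ℝ)

/-- ★ one monomial: `‖monoLoopU(k̄)‖ ≤ V²t·(majNE + majME + majBE).eval`. [folklore] -/
theorem monoLoop_le (hL : 64 ≤ L) (hΔ0 : 0 ≤ Δ) (hΔ1 : Δ < 1) (hf : IsGroundTwoMagnon L Δ lam2 f) (e0 : Tor L)
    (k3 k1 k2 : Bool) (k₂ k₃ : ℤ × ℤ) :
    ‖monoLoopU L Δ lam2 f e0 k3 k1 k2 (B1.toTor L k₂) (B1.toTor L k₃)‖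
      ≤ ((L : ℝ) ^ 2) ^ 2 * (2 * Real.pi / L) ^ 2 *
        (RExpr.add (.add (majNE k3 k1 k2) (majME k3 k1 k2 k₂ k₃)) (majBE k3 k1 k2)).eval (xTrueD L Δ lam2 f) := by
  have hLpos : (0 : ℝ) < L := by exact_mod_cast (show 0 < L by omega)
  have hθ : 0 < (2 * Real.pi / L : ℝ) := by positivity
  have hV : (0 : ℝ) < (L : ℝ) ^ 2 := by positivity
  -- the three semantic bounds
  have hN := norm_nvLoopU_le L Δ lam2 f hL hΔ0 hΔ1 hf k3 k1 k2 e0 (B1.toTor L k₂) (B1.toTor L k₃)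
  have hM := norm_mLoopU_le L Δ lam2 f hL hΔ0 hΔ1 hf k3 k1 k2 e0 k₂ k₃
  have hB := norm_bLoopU_le L Δ lam2 f hL hΔ0 hΔ1 hf k3 k1 k2 (B1.toTor L k₂) (B1.toTor L k₃)
  -- the eval identities
  have e3 := fun (a b c : Bool) => eval_bnd3E L Δ lam2 f hL hΔ0 hΔ1 hf a b c
  have eM := eval_bndME L Δ lam2 f hL hΔ0 hΔ1 hf k3 k1 k2
  have epg := fun (a b : Bool) => eval_bpgE L Δ lam2 f hL hΔ0 hΔ1 hf a b
  have esp := fun (a b : Bool) => eval_bspE L Δ lam2 f hL hΔ0 hΔ1 hf a b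
  have epv := fun (k : Bool) => eval_pvE L Δ lam2 f k
  have hsqrt : Real.sqrt (xTrueD L Δ lam2 f 0) = 2 * Real.pi / L := by rw [xTrueD_zero, Real.sqrt_sq hθ.le]
  have hline : ∀ x y : Bool, ((L : ℝ) ^ 2) ^ 2 * (2 * Real.pi / L) ^ 2 * (lineBndE x y).eval (xTrueD L Δ lam2 f) = lineBnd L Δ lam2 f x y / (L : ℝ) ^ 2 := by
    intro x y
    simp only [lineBndE, RExpr.eval, cst, vT, epg, esp, hsqrt]
    unfold lineBnd
    push_cast
    field_simp
  have hNE : ((L : ℝ) ^ 2) ^ 2 * (2 * Real.pi / L) ^ 2 * (majNE k3 k1 k2).eval (xTrueD L Δ lam2 f) = 6 * (bnd3Sum L Δ lam2 f k3 k1 k2 / (L : ℝ) ^ 2) := by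
    simp only [majNE, RExpr.eval, cst, e3]
    unfold bnd3Sum
    push_cast
    field_simp
  have hME : ((L : ℝ) ^ 2) ^ 2 * (2 * Real.pi / L) ^ 2 * (majME k3 k1 k2 k₂ k₃).eval (xTrueD L Δ lam2 f)
      = (2 * Real.pi / L) ^ 2 * (mMult k₂ k₃ : ℝ) * (bndMAt L Δ lam2 f k3 k1 k2 / (L : ℝ) ^ 2) := by
    simp only [majME, RExpr.eval, cst, eM]
    push_cast
    field_simp
  have hBE : ((L : ℝ) ^ 2) ^ 2 * (2 * Real.pi / L) ^ 2 * (majBE k3 k1 k2).eval (xTrueD L Δ lam2 f)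
      = (pvR L Δ lam2 f k1 * lineBnd L Δ lam2 f k3 k2 + pvR L Δ lam2 f k2 * lineBnd L Δ lam2 f k3 k1
          + pvR L Δ lam2 f k3 * lineBnd L Δ lam2 f k2 k1) / (L : ℝ) ^ 2 := by
    have h1 := hline k3 k2; have h2 := hline k3 k1; have h3 := hline k2 k1
    simp only [majBE, RExpr.eval, epv]
    linear_combination (pvR L Δ lam2 f k1) * h1 + (pvR L Δ lam2 f k2) * h2 + (pvR L Δ lam2 f k3) * h3
  unfold monoLoopU
  calc ‖nvLoopU L Δ lam2 f k3 k1 k2 e0 (B1.toTor L k₂) (B1.toTor L k₃) + mLoopU L Δ lam2 f k3 k1 k2 e0 (B1.toTor L k₂) (B1.toTor L k₃)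
        - bLoopU L Δ lam2 f k3 k1 k2 (B1.toTor L k₂) (B1.toTor L k₃)‖
      ≤ ‖nvLoopU L Δ lam2 f k3 k1 k2 e0 (B1.toTor L k₂) (B1.toTor L k₃)‖ + ‖mLoopU L Δ lam2 f k3 k1 k2 e0 (B1.toTor L k₂) (B1.toTor L k₃)‖
        + ‖bLoopU L Δ lam2 f k3 k1 k2 (B1.toTor L k₂) (B1.toTor L k₃)‖ := by
        refine (norm_sub_le _ _).trans ?_; gcongr; exact norm_add_le _ _
    _ ≤ _ := by
        rw [RExpr.eval, RExpr.eval, mul_add, mul_add, hNE, hME, hBE]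
        linarith

/-- ★ the total loop part: `‖loopTot(k̄)‖ ≤ V²t·(majLoopE k).eval`. [folklore] -/
theorem loopTot_le (hL : 64 ≤ L) (hΔ0 : 0 ≤ Δ) (hΔ1 : Δ < 1) (hf : IsGroundTwoMagnon L Δ lam2 f) (e0 : Tor L) (k₂ k₃ : ℤ × ℤ) :
    ‖loopTot L Δ lam2 f e0 (B1.toTor L k₂) (B1.toTor L k₃)‖
      ≤ ((L : ℝ) ^ 2) ^ 2 * (2 * Real.pi / L) ^ 2 * (majLoopE k₂ k₃).eval (xTrueD L Δ lam2 f) := by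
  have T := fun (k3 k1 k2 : Bool) => monoLoop_le L Δ lam2 f hL hΔ0 hΔ1 hf e0 k3 k1 k2 k₂ k₃
  unfold loopTot majLoopE
  rw [eval_sumE]
  simp only [monoList, List.map, List.sum_cons, List.sum_nil, add_zero, mul_add]
  have e1 := T true false false; have e2 := T false false true; have e3 := T true false true
  have e4 := T false true false; have e5 := T true true false; have e6 := T false true true; have e7 := T true true true
  exact norm_add_le_of_le e1 (norm_add_le_of_le e2 (norm_add_le_of_le e3 (norm_add_le_of_le e4
    (norm_add_le_of_le e5 (norm_add_le_of_le e6 e7)))))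

/-- ★ the `NT` loop: `‖ntLoopU(k)‖ ≤ 3·Σ_8 bndMAt/V = 3·V²·ntBndE.eval`. [folklore] -/
theorem ntLoop_le (hL : 64 ≤ L) (hΔ0 : 0 ≤ Δ) (hΔ1 : Δ < 1) (hf : IsGroundTwoMagnon L Δ lam2 f) (e0 : Tor L) (k₂ k₃ : Tor L) :
    ‖ntLoopU L Δ lam2 f e0 k₂ k₃‖ ≤ 3 * (((L : ℝ) ^ 2) ^ 2 * ntBndE.eval (xTrueD L Δ lam2 f)) := by
  have hLpos : (0 : ℝ) < L := by exact_mod_cast (show 0 < L by omega)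
  have P := fun (k3 k1 k2 : Bool) (q₂ q₃ : Tor L) =>
    norm_loopPartU_plain_le L Δ lam2 f hL hΔ0 hΔ1 hf k3 k1 k2 e0 e0 e0 q₂ q₃
  have hpi : ∀ q₂ q₃ : Tor L, ‖piLoopU L Δ lam2 f e0 q₂ q₃‖ ≤ ((L : ℝ) ^ 2) ^ 2 * ntBndE.eval (xTrueD L Δ lam2 f) := by
    intro q₂ q₃
    unfold piLoopU ntBndE
    rw [eval_sumE]
    simp only [monoList8, monoList, List.map, List.sum_cons, List.sum_nil, add_zero, mul_add,
      eval_bndME L Δ lam2 f hL hΔ0 hΔ1 hf]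
    have hc : ∀ k3 k1 k2 : Bool, ((L : ℝ) ^ 2) ^ 2 * (bndMAt L Δ lam2 f k3 k1 k2 / ((L : ℝ) ^ 2) ^ 3)
        = bndMAt L Δ lam2 f k3 k1 k2 / (L : ℝ) ^ 2 := by
      intro k3 k1 k2; field_simp
    simp only [hc]
    exact norm_add_le_of_le (P _ _ _ q₂ q₃) (norm_add_le_of_le (P _ _ _ q₂ q₃) (norm_add_le_of_le (P _ _ _ q₂ q₃)
      (norm_add_le_of_le (P _ _ _ q₂ q₃) (norm_add_le_of_le (P _ _ _ q₂ q₃) (norm_add_le_of_le (P _ _ _ q₂ q₃)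
      (norm_add_le_of_le (P _ _ _ q₂ q₃) (P _ _ _ q₂ q₃)))))))
  unfold ntLoopU
  have h1 := hpi k₂ k₃; have h2 := hpi (k₂ - K1 L) k₃; have h3 := hpi k₂ (k₃ - K1 L)
  have := norm_add_le_of_le (norm_add_le_of_le h1 h2) h3
  linarith

/-- ★★ THE NORM BOUND of a low coefficient (ground profile located in a row-D cell, `L ≥ 128`; `τlo·θ² ≤ T⁺ ≤ τhi·θ²`; `rhoOk k`). -/
theorem rhat_norm_le (hL : 64 ≤ L) (hΔ0 : 0 ≤ Δ) (hΔ1 : Δ < 1) (hf : IsGroundTwoMagnon L Δ lam2 f)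
    (τlo τhi : ℚ) (hτlo : (τlo : ℝ) * (2 * Real.pi / L) ^ 2 ≤ Tplus L Δ f) (hτhi : Tplus L Δ f ≤ (τhi : ℝ) * (2 * Real.pi / L) ^ 2)
    {k₂ k₃ : ℤ × ℤ} (hok : rhoOk k₂ k₃ = true) :
    ‖cfgDFT L (resid L Δ f) (B1.toTor L k₂) (B1.toTor L k₃)‖
      ≤ ((L : ℝ) ^ 2) ^ 2 * (2 * Real.pi / L) ^ 2 *
        (|(rhoE k₂ k₃).1.eval (xTrueD L Δ lam2 f)| + (majE τlo τhi k₂ k₃).eval (xTrueD L Δ lam2 f)) := by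
  have hLpos : (0 : ℝ) < L := by exact_mod_cast (show 0 < L by omega)
  have hθ : 0 < (2 * Real.pi / L : ℝ) := by positivity
  have ht : 0 < (2 * Real.pi / L : ℝ) ^ 2 := by positivity
  have hV : (0 : ℝ) < (L : ℝ) ^ 2 := by positivity
  have hlam : 0 < lam2 := lam2_pos L (by omega) hΔ1 hf.1
  have hreal := rhat_norm_eq_abs_re L hf (B1.toTor L k₂) (B1.toTor L k₃)
  rw [hreal, rhat_decomp_eval L Δ lam2 f (by omega) hΔ0 hΔ1 hf hlam 0 hok]
  have hnV : ‖((L : ℂ) ^ 2) ^ 2‖ = ((L : ℝ) ^ 2) ^ 2 := by rw [norm_pow, norm_pow]; simp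
  -- piece A: the closed pair, real part
  have hA : (((L : ℂ) ^ 2) ^ 2 * ((((2 * Real.pi / L) ^ 2 : ℝ) : ℂ) * peval (2 * Real.pi / L) (xTrueD L Δ lam2 f) (rhoE k₂ k₃))).re
      = ((L : ℝ) ^ 2) ^ 2 * (2 * Real.pi / L) ^ 2 * (rhoE k₂ k₃).1.eval (xTrueD L Δ lam2 f) := by
    unfold peval
    simp only [Complex.mul_re, Complex.add_re, Complex.ofReal_re, Complex.ofReal_im, Complex.mul_im, Complex.I_re, Complex.I_im,
      Complex.add_im]
    have : (((L : ℂ) ^ 2) ^ 2).re = ((L : ℝ) ^ 2) ^ 2 ∧ (((L : ℂ) ^ 2) ^ 2).im = 0 := by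
      constructor
      · norm_cast
      · norm_cast
    rw [this.1, this.2]
    ring
  -- piece B: the loops
  have hB := loopTot_le L Δ lam2 f hL hΔ0 hΔ1 hf 0 k₂ k₃
  -- piece C: the NT term
  have hν2 : xTrueD L Δ lam2 f 2 = lam2 / (2 * Real.pi / L) ^ 2 := xTrueD_two L Δ lam2 f
  have hτ : |Tplus L Δ f - 3 * lam2| ≤ (2 * Real.pi / L) ^ 2 * (tdevE τlo τhi).eval (xTrueD L Δ lam2 f) := by
    simp only [tdevE, RExpr.eval, cst, vNu, hν2]
    push_cast
    have h3 : Tplus L Δ f - 3 * lam2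
        = (2 * Real.pi / L) ^ 2 * (Tplus L Δ f / (2 * Real.pi / L) ^ 2 - 3 * (lam2 / (2 * Real.pi / L) ^ 2)) := by
      field_simp
    rw [h3, abs_mul, abs_of_pos ht]
    refine mul_le_mul_of_nonneg_left ?_ ht.le
    apply abs_le_max_abs_abs
    · have : (τlo : ℝ) ≤ Tplus L Δ f / (2 * Real.pi / L) ^ 2 := by rw [le_div_iff₀ ht]; exact hτlo
      linarith
    · have : Tplus L Δ f / (2 * Real.pi / L) ^ 2 ≤ (τhi : ℝ) := by rw [div_le_iff₀ ht]; exact hτhi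
      linarith
  have hC : ‖(((Tplus L Δ f - 3 * lam2 : ℝ) : ℂ))
        * (((L : ℂ) ^ 2) ^ 2 * ((((ntClosedE k₂ k₃).eval (xTrueD L Δ lam2 f) : ℝ)) : ℂ) + ntLoopU L Δ lam2 f 0 (B1.toTor L k₂) (B1.toTor L k₃))‖
      ≤ ((L : ℝ) ^ 2) ^ 2 * (2 * Real.pi / L) ^ 2 * (majNTE τlo τhi k₂ k₃).eval (xTrueD L Δ lam2 f) := by
    rw [norm_mul, Complex.norm_real, Real.norm_eq_abs]
    have hin : ‖((L : ℂ) ^ 2) ^ 2 * ((((ntClosedE k₂ k₃).eval (xTrueD L Δ lam2 f) : ℝ)) : ℂ) + ntLoopU L Δ lam2 f 0 (B1.toTor L k₂) (B1.toTor L k₃)‖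
        ≤ ((L : ℝ) ^ 2) ^ 2 * (|(ntClosedE k₂ k₃).eval (xTrueD L Δ lam2 f)| + 3 * ntBndE.eval (xTrueD L Δ lam2 f)) := by
      have h1 : ‖((L : ℂ) ^ 2) ^ 2 * ((((ntClosedE k₂ k₃).eval (xTrueD L Δ lam2 f) : ℝ)) : ℂ)‖ = ((L : ℝ) ^ 2) ^ 2 * |(ntClosedE k₂ k₃).eval (xTrueD L Δ lam2 f)| := by
        rw [norm_mul, Complex.norm_real, Real.norm_eq_abs, hnV]
      have h2 := ntLoop_le L Δ lam2 f hL hΔ0 hΔ1 hf 0 (B1.toTor L k₂) (B1.toTor L k₃)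
      refine (norm_add_le _ _).trans ?_
      rw [h1]
      linarith
    have hdev0 : 0 ≤ (2 * Real.pi / L) ^ 2 * (tdevE τlo τhi).eval (xTrueD L Δ lam2 f) := le_trans (abs_nonneg _) hτ
    calc |Tplus L Δ f - 3 * lam2| * ‖((L : ℂ) ^ 2) ^ 2 * ((((ntClosedE k₂ k₃).eval (xTrueD L Δ lam2 f) : ℝ)) : ℂ) + ntLoopU L Δ lam2 f 0 (B1.toTor L k₂) (B1.toTor L k₃)‖
        ≤ ((2 * Real.pi / L) ^ 2 * (tdevE τlo τhi).eval (xTrueD L Δ lam2 f)) * (((L : ℝ) ^ 2) ^ 2 * (|(ntClosedE k₂ k₃).eval (xTrueD L Δ lam2 f)| + 3 * ntBndE.eval (xTrueD L Δ lam2 f))) :=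
          mul_le_mul hτ hin (norm_nonneg _) hdev0
      _ = ((L : ℝ) ^ 2) ^ 2 * (2 * Real.pi / L) ^ 2 * (majNTE τlo τhi k₂ k₃).eval (xTrueD L Δ lam2 f) := by
          simp only [majNTE, RExpr.eval, cst]; push_cast; ring
  -- assemble: `|Re(A + B − C)| ≤ |Re A| + ‖B‖ + ‖C‖`
  simp only [majE, RExpr.eval]
  rw [Complex.sub_re, Complex.add_re, hA]
  have hBre := (Complex.abs_re_le_norm (loopTot L Δ lam2 f 0 (B1.toTor L k₂) (B1.toTor L k₃))).trans hB
  have hCre := (Complex.abs_re_le_norm ((((Tplus L Δ f - 3 * lam2 : ℝ) : ℂ))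
        * (((L : ℂ) ^ 2) ^ 2 * ((((ntClosedE k₂ k₃).eval (xTrueD L Δ lam2 f) : ℝ)) : ℂ)
          + ntLoopU L Δ lam2 f 0 (B1.toTor L k₂) (B1.toTor L k₃)))).trans hC
  have hVt : 0 ≤ ((L : ℝ) ^ 2) ^ 2 * (2 * Real.pi / L) ^ 2 := by positivity
  have hx : |((L : ℝ) ^ 2) ^ 2 * (2 * Real.pi / L) ^ 2 * (rhoE k₂ k₃).1.eval (xTrueD L Δ lam2 f)|
      = ((L : ℝ) ^ 2) ^ 2 * (2 * Real.pi / L) ^ 2 * |(rhoE k₂ k₃).1.eval (xTrueD L Δ lam2 f)| := by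
    rw [abs_mul, abs_of_nonneg hVt]
  have habs := abs_sub (((L : ℝ) ^ 2) ^ 2 * (2 * Real.pi / L) ^ 2 * (rhoE k₂ k₃).1.eval (xTrueD L Δ lam2 f)
      + (loopTot L Δ lam2 f 0 (B1.toTor L k₂) (B1.toTor L k₃)).re)
    ((((Tplus L Δ f - 3 * lam2 : ℝ) : ℂ)) * (((L : ℂ) ^ 2) ^ 2 * ((((ntClosedE k₂ k₃).eval (xTrueD L Δ lam2 f) : ℝ)) : ℂ)
        + ntLoopU L Δ lam2 f 0 (B1.toTor L k₂) (B1.toTor L k₃))).re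
  have hadd := abs_add_le (((L : ℝ) ^ 2) ^ 2 * (2 * Real.pi / L) ^ 2 * (rhoE k₂ k₃).1.eval (xTrueD L Δ lam2 f))
    (loopTot L Δ lam2 f 0 (B1.toTor L k₂) (B1.toTor L k₃)).re
  rw [hx] at hadd
  linarith [habs, hadd, hBre, hCre]

end bound

end T

end RowD

end Summit.HubbardSuperconductivity.HubbardSuperconductivity.Theorems.AnisotropyChord.Transfer.Fibre3
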